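import Literature.AnabelianGeometry.EtaleTheta.GalSectCuspidalTorsorsProofs
import HarnessLib

/-!
# [EtTh] Thm. 1.6 (iii), proof p.251 l.31–38: from cusp evaluations to the core identity
# `x₂ ∈ κ(O^×_K̈) · x₁` — proof-only glue for sub-DAG row L15 / `Thm16Sub.thm16iii_of_core`

Mochizuki, *The étale theta function …* [EtTh], Publ. RIMS **45** (2009), Thm. 1.6 (iii), proof p.251
(PRIMS PDF p.25) l.31–38: «reduction of indeterminacy from `(K̈^×)^∧` to `O^×_K̈`» by evaluating at a cusp
through a section compatible with the canonical integral structure (Prop. 1.4 (iii), cusp clause)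
[cite: MochizukiEtTh2009, Thm 1.6 (iii) p.25].  abc-iut cell, layer L2 (seat abc-iut-w5-d062 gen 2; ROW (A)
lineage).  PROOF-ONLY (no definitions, no named facts).

abc-iut-L6-d5's assembly `Thm16Sub.thm16iii_of_core` (Thm16SubdagTransport.lean) takes as its third input
`heta : ∃ u ∈ Eβ.kumUnitsYdd, transport c h Eα.etaDd = u * conj_σ Eβ.etaDd`.  Rows L12–L14 of the sub-DAG
produce the weaker `transport … = infl(kumYdd a) * conj_σ …` with `a ∈ (K̈^×)^∧`; row L15 is the step
`a ∈ O^×_K̈`.  Over the cusp-evaluation carrier `ThetaSetting.CuspidalPointDd` (ROW (A), p419967) and its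
kernel lemma `kum_factor_mem_units_of_cuspValues` (p420496) this file states the step in EXACTLY the
shape `heta` consumes: `exists_mem_kumUnitsYdd_mul_of_cuspValues`.  Its two «both classes evaluate at the
cusp `y` to `O^×_K̈`-multiples of values of equal absolute value» hypotheses are what Prop. 1.4 (iii)
(`Prop14iiiCuspValues`, β-side) and its transport along `γ` (α-side; [AbsAnab] value preservation) supply.

HONEST FRAMING: elementary; nothing here bears on [IUTchIII] Cor. 3.12; typed ≠ endorsed.
-/

namespace Literature.AnabelianGeometry.EtaleTheta

namespace ThetaSetting

namespace CuspidalPointDd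

variable {p : ℕ} [Fact p.Prime] {D : ThetaSetting p} {E : D.KummerData} (y : CuspidalPointDd E)

/-- The Kummer class (inflated to `Π^tp_Ÿ`) of a unit `u ∈ O^×_K̈` lies in `κ(O^×_K̈) = kumUnitsYdd`.
[cite: MochizukiEtTh2009, Prop 1.3 p.21] -/
theorem infl_kumYdd_toKddHat_mem_kumUnitsYdd {u : (↥D.Kdd)ˣ} (hu : u ∈ D.unitsOKdd) :
    D.inflTheta D.GtpYdd (E.kumYdd (E.toKddHat u)) ∈ E.kumUnitsYdd :=
  ⟨E.toKddHat u, ⟨u, hu, rfl⟩, rfl⟩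

/-- **[EtTh] Thm. 1.6 (iii), p.251 l.31–38, in the shape of `Thm16Sub.thm16iii_of_core`'s input `heta`**:
if `x₂ = κ(a) · x₁` for some `a ∈ (K̈^×)^∧` (rows L12–L14), and both `x₁` and `x₂` evaluate at the cusp
`y` — through the section compatible with the canonical integral structure — to `u₁·v₁`, `u₂·v₂` with
`u₁, u₂ ∈ O^×_K̈`, `‖v₁‖ = ‖v₂‖`, then `x₂ ∈ κ(O^×_K̈) · x₁` — PROVED (via
`kum_factor_mem_units_of_cuspValues`: `a = κ(u)` for the unit `u = u₂v₂(u₁v₁)⁻¹`).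
[cite: MochizukiEtTh2009, Thm 1.6 (iii) p.25] -/
theorem exists_mem_kumUnitsYdd_mul_of_cuspValues {x₁ x₂ : D.H1 D.GtpYdd} (a : E.KddHat)
    (hx : x₂ = D.inflTheta D.GtpYdd (E.kumYdd a) * x₁)
    {u₁ u₂ v₁ v₂ : (↥D.Kdd)ˣ} (hu₁ : u₁ ∈ D.unitsOKdd) (hu₂ : u₂ ∈ D.unitsOKdd)
    (hv : ‖((v₁ : D.Kdd) : PadicAlgCl p)‖ = ‖((v₂ : D.Kdd) : PadicAlgCl p)‖)
    (h₁ : y.evalAt (ContH1.res D.toTheta D.DeltaTheta (y.sec_le.trans y.Dpt_le) x₁) =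
      E.toKddHat (u₁ * v₁))
    (h₂ : y.evalAt (ContH1.res D.toTheta D.DeltaTheta (y.sec_le.trans y.Dpt_le) x₂) =
      E.toKddHat (u₂ * v₂)) :
    ∃ u ∈ E.kumUnitsYdd, x₂ = u * x₁ := by
  subst hx
  obtain ⟨u, hu, rfl⟩ := y.kum_factor_mem_units_of_cuspValues a x₁ hu₁ hu₂ hv h₁ h₂
  exact ⟨_, infl_kumYdd_toKddHat_mem_kumUnitsYdd hu, rfl⟩

/-- The same, with the roles packaged as print has them: `x₁` a `Π^tp_X/Π^tp_Y`-conjugate of the β-class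
and `x₂` the transported α-class are left abstract; only the EVALUATIONS and the `(K̈^×)^∧`-factor
matter.  Corollary: the factor class `κ(a)` itself lies in `κ(O^×_K̈)`.
[cite: MochizukiEtTh2009, Thm 1.6 (iii) p.25] -/
theorem infl_kumYdd_mem_kumUnitsYdd_of_cuspValues {x₁ : D.H1 D.GtpYdd} (a : E.KddHat)
    {u₁ u₂ v₁ v₂ : (↥D.Kdd)ˣ} (hu₁ : u₁ ∈ D.unitsOKdd) (hu₂ : u₂ ∈ D.unitsOKdd)
    (hv : ‖((v₁ : D.Kdd) : PadicAlgCl p)‖ = ‖((v₂ : D.Kdd) : PadicAlgCl p)‖)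
    (h₁ : y.evalAt (ContH1.res D.toTheta D.DeltaTheta (y.sec_le.trans y.Dpt_le) x₁) =
      E.toKddHat (u₁ * v₁))
    (h₂ : y.evalAt (ContH1.res D.toTheta D.DeltaTheta (y.sec_le.trans y.Dpt_le)
        (D.inflTheta D.GtpYdd (E.kumYdd a) * x₁)) = E.toKddHat (u₂ * v₂)) :
    D.inflTheta D.GtpYdd (E.kumYdd a) ∈ E.kumUnitsYdd := by
  obtain ⟨u, hu, rfl⟩ := y.kum_factor_mem_units_of_cuspValues a x₁ hu₁ hu₂ hv h₁ h₂
  exact infl_kumYdd_toKddHat_mem_kumUnitsYdd hu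

end CuspidalPointDd

end ThetaSetting

end Literature.AnabelianGeometry.EtaleTheta
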